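import Summits.BirchSwinnertonDyer.BirchSwinnertonDyer.Theorems.CyclotomicUntwistGNineNineGoodModelOfPSRow
import Summits.BirchSwinnertonDyer.BirchSwinnertonDyer.Theorems.CyclotomicUntwistNineRankTwoReduction
import Summits.BirchSwinnertonDyer.BirchSwinnertonDyer.Theses.CyclotomicUntwist
import HarnessLib

/-!
# The print package C2 `PSDescendedFrobeniusPrintedInputsAtThree` (item stmt-BirchSwinnertonDyer-27549) costs EXACTLY
# Gross–Zagier–Kolyvagin and Katz's rank theorem (Katz 1981 Thm 5.3.3) — the Berthelot–Ogus/Katz existence fact is DERIVED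

Cell `pub/bsd-wall` (D-0145 line `route-BirchSwinnertonDyer-CyclotomicUntwist`, rev 9), prover seat `bsd-line-cycu-p5` (gen 10).
CONDITIONAL by design (the two hypotheses are printed theorems, carried as Literature named facts); THEOREMS ONLY; BSD is not
proved by this file and no crux is; the item is NOT closed (its own signature contains `PublishedInputGZK`).

* **`psDescendedFrobeniusPrintedInputsAtThree_of_gzk_of_katzRank`** — item C2 BY NAME from
  `(hGZK : rank_eq_analyticRank_of_analyticRank_le_one) (hK : katz_dieudonne_rank_le_two)`: cycu-p3's
  `GNineFrobeniusTrace.stub_descendedFrobenius_of_exists hex` (route-independent module; same composition as cycu-p3's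
  `psDescendedFrobeniusPrintedInputsAtThree_of_print`) with `hex := NineRankTwoReduction.isDescendedFrobeniusMatrix_exists_of_katzRank hK` (the `cycu` seats' kernel theorems: second kind of
  `[ω], φ[ω], [η]`, `ClassesIndependent`, `ω`-plane independence, `ℚ₃`-descent, model transport, Honda, det/tr/power maps).
* `stub_descendedFrobenius_of_katzRank` — the registered text of `stub_descendedFrobenius` (second conjunct of C2) from `hK` alone.
[cite: GrossZagier1986, Thm. I.6.3] [cite: Kolyvagin1990, Thm. A] [cite: Katz1981CrystallineDieudonne, Thm. 5.3.3]
-/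

-- single-conjunct summit: `Summit.BirchSwinnertonDyer.BirchSwinnertonDyer.…` repeats the name by design
set_option linter.dupNamespace false
set_option autoImplicit false

noncomputable section

open Literature.NumberTheory.EllipticCurves.DescendedFrobenius
  Summit.BirchSwinnertonDyer.BirchSwinnertonDyer.Theses.CyclotomicUntwist
  Summit.BirchSwinnertonDyer.BirchSwinnertonDyer.Theorems.NineIntegers

namespace Summit.BirchSwinnertonDyer.BirchSwinnertonDyer.Theorems.NineRankTwoReduction

/-- **`stub_descendedFrobenius` (= the second conjunct of C2) GRANTED ONLY Katz's rank theorem**: for every `W/ℚ` elliptic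
and globally minimal on a principal-series row, `∃ M, W.IsDescendedFrobeniusMatrix M ∧ tr M = ↑(W.psUntwistedTrace) ∧ M 1 0 ≠ 0`.
[cite: Katz1981CrystallineDieudonne, Thm. 5.3.3] [cite: BerthelotOgus1983, Thm. (2.4) and Prop. (3.14)] -/
theorem stub_descendedFrobenius_of_katzRank (hK : Literature.NumberTheory.EllipticCurves.katz_dieudonne_rank_le_two) :
    ∀ (W : WeierstrassCurve ℚ) [W.IsElliptic] [W.IsGloballyMinimal],
      Summit.BirchSwinnertonDyer.Rank1Residual.Additive.ClassO6 W 3 →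
      Even (padicValInt 3 W.minimalDiscriminantInt) →
      W.minimalDiscriminantInt / 3 ^ padicValInt 3 W.minimalDiscriminantInt % 3 = 1 →
      ∃ M : Matrix (Fin 2) (Fin 2) ℚ_[3], W.IsDescendedFrobeniusMatrix M ∧
        M.trace = ((W.psUntwistedTrace : ℤ) : ℚ_[3]) ∧ M 1 0 ≠ 0 :=
  GNineFrobeniusTrace.stub_descendedFrobenius_of_exists (isDescendedFrobeniusMatrix_exists_of_katzRank hK)
    (Classical.choice nonempty_residueMap)

/-- **Item C2 = `PSDescendedFrobeniusPrintedInputsAtThree` (stmt-BirchSwinnertonDyer-27549) from its TWO printed facts**: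
Gross–Zagier–Kolyvagin (`rank_eq_analyticRank_of_analyticRank_le_one` = `PublishedInputGZK`) and Katz's rank theorem
`katz_dieudonne_rank_le_two` (Katz 1981 Thm 5.3.3, special case) — the Berthelot–Ogus/Katz EXISTENCE of the descended Frobenius
matrix is no longer an input. CONDITIONAL by design. [cite: GrossZagier1986, Thm. I.6.3] [cite: Kolyvagin1990, Thm. A]
[cite: Katz1981CrystallineDieudonne, Thm. 5.3.3] -/
theorem psDescendedFrobeniusPrintedInputsAtThree_of_gzk_of_katzRank
    (hGZK : Literature.NumberTheory.EllipticCurves.rank_eq_analyticRank_of_analyticRank_le_one)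
    (hK : Literature.NumberTheory.EllipticCurves.katz_dieudonne_rank_le_two) :
    PSDescendedFrobeniusPrintedInputsAtThree :=
  ⟨hGZK, fun W _ _ hO6 hev hsq => stub_descendedFrobenius_of_katzRank hK W hO6 hev hsq⟩

end Summit.BirchSwinnertonDyer.BirchSwinnertonDyer.Theorems.NineRankTwoReduction

end
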